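import Literature.AnabelianGeometry.AbsoluteAnabelian.MonoidKummerMapsMonoAnalyticLiftHolds
import Literature.AnabelianGeometry.AbsoluteAnabelian.MLFGaloisMonoAnalyticModel
import HarnessLib

/-!
# [AbsTopIII] Prop 3.2 (iv) / [IUTchII] Ex 1.8 (ii): `G ↦ (G ↷ 𝒪^⊳(G))` is FUNCTORIAL in isomorphisms of `G_k`
# — every isomorphism of Galois groups lifts UNIQUELY to the model `TM`-pairs, and the lifts compose
# (proof-only; the kernel input of the GENUINE instance of abc-iut-L6-t1's `AbsTopMonoids` = MERGE-MAP row B9)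

S. Mochizuki, *Topics in absolute anabelian geometry III*, Prop. 3.2 (iv) p. 72 (kurims `paper:url-5493eb38cbb7`): the
functor of Def. 3.1 (iii) «induces an injection … this injection is a bijection if …»; *Inter-universal Teichmüller
theory II*, §1, Example 1.8 (ii) p. 36 («functorial group-theoretic algorithm `G ↦ (G ↷ O^⊳(G))`») and (iii) p. 38
(«a `Γ`-multiple of the isomorphism of ind-topological modules equipped with topological group actions
`(G ↷ O^×(G)) ⥲ (G* ↷ O^×(G*))` induced by an isomorphism of topological groups `G ⥲ G*`»; in this file only the
underlying isomorphism of monoids-with-Galois-action is modelled — the ind-topological module structure of print is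
not typed here, and no Lean statement below depends on it; referee note K19-n1, doc-only v2), kurims
`paper:url-5036b4059555`.

With F-0410 PROVED (`galoisIsoLiftsToTMPairIsoOfMonoAnalytic_holds`, abc-iut-L6-t13 over abc-iut-L4-d3's
`Prop121vii.unitsTransport_holds`) and the injectivity `pairIsoDeterminedByGalois_holds` (abc-iut-L6-t13 gen 2), the
model `TM`-pairs `(G_k ↷ 𝒪_k̄^⊳)` of mono-analytic type (abc-iut-L4-t2's `(ModelMLFGaloisData.galois k k̄).tmPair`)
form a functor on the groupoid of topological isomorphisms of absolute Galois groups of MLFs: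

* `MLFClosure.existsUnique_tmPairLift` — every `f : G_{k₁} ⥲ G_{k₂}` (topological) lifts to EXACTLY ONE
  `f`-equivariant `𝒪_{k̄₁}^⊳ ⥲ 𝒪_{k̄₂}^⊳`;
* `MLFClosure.tmPairLift_refl / _symm / _trans` — the unique lifts of `id`, `f⁻¹`, `g ∘ f` are `id`, the inverse, the
  composite (the functor laws of [IUTchII] Ex 1.8 (ii)/(iii)'s `(*⊳)`, i.e. exactly the fields `mapOtri_id`,
  `mapOtri_comp`, `mapOtri_equivariant` of `AbsTopMonoids` at the genuine monoids, for any choice of lifts).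

HONEST FRAMING: OUR kernel consequence of a refereed 2015 statement from classical LCFT; nothing here bears on
[IUTchIII] Cor. 3.12; no side taken; abc-iut seat abc-iut-L6-t13 (gen 4).
-/

noncomputable section

namespace Literature.AnabelianGeometry.AbsoluteAnabelian

namespace MLFClosure

variable (C₁ C₂ C₃ : MLFClosure.{0})

/-- **Unique lifting** ([AbsTopIII] Prop 3.2 (iv) for the mono-analytic model pairs, now unconditional): every
isomorphism of topological groups `f : G_{k₁} ⥲ G_{k₂}` is the Galois component of EXACTLY ONE isomorphism of the
model `TM`-pairs `(G_{k₁} ↷ 𝒪_{k̄₁}^⊳) ⥲ (G_{k₂} ↷ 𝒪_{k̄₂}^⊳)` — existence is F-0410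
(`galoisIsoLiftsToTMPairIsoOfMonoAnalytic_holds`), uniqueness of the monoid component is
`pairIsoDeterminedByGalois_holds`. [cite: MochizukiAbsTopIII2015, Proposition 3.2 (iv) p.72] -/
theorem existsUnique_tmPairLift
    (f : (ModelMLFGaloisData.galois C₁.k C₁.K).tmPair.Pi ≃ₜ* (ModelMLFGaloisData.galois C₂.k C₂.K).tmPair.Pi) :
    ∃! φ : (ModelMLFGaloisData.galois C₁.k C₁.K).tmPair.M ≃* (ModelMLFGaloisData.galois C₂.k C₂.K).tmPair.M,
      ∀ (σ : (ModelMLFGaloisData.galois C₁.k C₁.K).tmPair.Pi) (x : (ModelMLFGaloisData.galois C₁.k C₁.K).tmPair.M),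
        φ (σ • x) = f σ • φ x := by
  obtain ⟨e, he⟩ := galoisIsoLiftsToTMPairIsoOfMonoAnalytic_holds _ _
    (isMLFGaloisMonoidPair_galois_tmPair C₁) (isMLFGaloisMonoidPair_galois_tmPair C₂)
    (isOfMonoAnalyticTypeMonoid_galois_tmPair C₁) (isOfMonoAnalyticTypeMonoid_galois_tmPair C₂) f
  refine ⟨e.isoM, fun σ x => by rw [e.smul_comm, he], fun φ hφ => ?_⟩
  have h := pairIsoDeterminedByGalois_holds _ _ (isMLFGaloisMonoidPair_galois_tmPair C₁)
    (isMLFGaloisMonoidPair_galois_tmPair C₂) ⟨f, φ, hφ⟩ e (by rw [he])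
  exact h

/-- **Functor law: identity.**  The unique lift of `id_{G_k}` is the identity of `𝒪_k̄^⊳` (any isomorphism of the
model pair over `id` has identity monoid component). [cite: Mochizuki2012, IUTchII Ex 1.8 (ii) p.36] -/
theorem tmPairLift_refl
    (e : GaloisMonoidPair.Iso (ModelMLFGaloisData.galois C₁.k C₁.K).tmPair (ModelMLFGaloisData.galois C₁.k C₁.K).tmPair)
    (he : e.isoPi = ContinuousMulEquiv.refl _) : e.isoM = MulEquiv.refl _ :=
  pairIsoDeterminedByGalois_holds _ _ (isMLFGaloisMonoidPair_galois_tmPair C₁)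
    (isMLFGaloisMonoidPair_galois_tmPair C₁) e (GaloisMonoidPair.Iso.refl _) (by rw [he]; rfl)

variable {C₁ C₂ C₃}

/-- **Functor law: composition** («the isomorphism `(G ↷ O^×(G)) ≅ (G* ↷ O^×(G*))` induced by an isomorphism of
topological groups `G ≅ G*`» composes): if `e₁₂` lifts `f`, `e₂₃` lifts `g` and `e₁₃` lifts `g ∘ f`, then the monoid
component of `e₁₃` is the composite of those of `e₁₂`, `e₂₃`. [cite: Mochizuki2012, IUTchII Ex 1.8 (iii) p.38] -/
theorem tmPairLift_trans
    {e₁₂ : GaloisMonoidPair.Iso (ModelMLFGaloisData.galois C₁.k C₁.K).tmPair (ModelMLFGaloisData.galois C₂.k C₂.K).tmPair}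
    {e₂₃ : GaloisMonoidPair.Iso (ModelMLFGaloisData.galois C₂.k C₂.K).tmPair (ModelMLFGaloisData.galois C₃.k C₃.K).tmPair}
    {e₁₃ : GaloisMonoidPair.Iso (ModelMLFGaloisData.galois C₁.k C₁.K).tmPair (ModelMLFGaloisData.galois C₃.k C₃.K).tmPair}
    (h : e₁₃.isoPi = e₁₂.isoPi.trans e₂₃.isoPi) : e₁₃.isoM = e₁₂.isoM.trans e₂₃.isoM :=
  pairIsoDeterminedByGalois_holds _ _ (isMLFGaloisMonoidPair_galois_tmPair C₁)
    (isMLFGaloisMonoidPair_galois_tmPair C₃) e₁₃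
    ⟨e₁₂.isoPi.trans e₂₃.isoPi, e₁₂.isoM.trans e₂₃.isoM, fun σ x => by
      show e₂₃.isoM (e₁₂.isoM (σ • x)) = e₂₃.isoPi (e₁₂.isoPi σ) • e₂₃.isoM (e₁₂.isoM x)
      rw [e₁₂.smul_comm, e₂₃.smul_comm]⟩ h

/-- **Functor law: inverse.**  If `e` lifts `f` and `e'` lifts `f⁻¹` then the monoid component of `e'` is the inverse
of that of `e`. [cite: Mochizuki2012, IUTchII Ex 1.8 (iii) p.38] -/
theorem tmPairLift_symm
    {e : GaloisMonoidPair.Iso (ModelMLFGaloisData.galois C₁.k C₁.K).tmPair (ModelMLFGaloisData.galois C₂.k C₂.K).tmPair}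
    {e' : GaloisMonoidPair.Iso (ModelMLFGaloisData.galois C₂.k C₂.K).tmPair (ModelMLFGaloisData.galois C₁.k C₁.K).tmPair}
    (h : e'.isoPi = e.isoPi.symm) : e'.isoM = e.isoM.symm :=
  pairIsoDeterminedByGalois_holds _ _ (isMLFGaloisMonoidPair_galois_tmPair C₂)
    (isMLFGaloisMonoidPair_galois_tmPair C₁) e'
    ⟨e.isoPi.symm, e.isoM.symm, fun σ x => GaloisMonoidPair.Iso.symm_smul_comm e σ x⟩ h

/-- **Equivariance is automatic for ANY choice of lifts**: two isomorphisms of the model pairs with the same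
Galois component agree on `𝒪^⊳` — so `G ↦ 𝒪_k̄^⊳`, `f ↦` (the monoid component of any lift of `f`) is a well-defined
functor from the groupoid of topological isomorphisms of absolute Galois groups of MLFs to monoids with group action
(the `(*⊳)` of [IUTchII] Ex 1.8 (ii) at the genuine monoids). [cite: Mochizuki2012, IUTchII Ex 1.8 (ii) p.36] -/
theorem tmPairLift_isoM_eq
    {e e' : GaloisMonoidPair.Iso (ModelMLFGaloisData.galois C₁.k C₁.K).tmPair (ModelMLFGaloisData.galois C₂.k C₂.K).tmPair}
    (h : e.isoPi = e'.isoPi) : e.isoM = e'.isoM :=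
  pairIsoDeterminedByGalois_holds _ _ (isMLFGaloisMonoidPair_galois_tmPair C₁)
    (isMLFGaloisMonoidPair_galois_tmPair C₂) e e' h

end MLFClosure

end Literature.AnabelianGeometry.AbsoluteAnabelian

end
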